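import Mathlib
import Literature.MathematicalPhysics.QuantumFieldTheory.Balaban1983to89.B11Prop8Assembly
import Literature.MathematicalPhysics.QuantumFieldTheory.Balaban1983to89.B11Holder9
import Literature.MathematicalPhysics.QuantumFieldTheory.Balaban1983to89.B11Smallness

/-!
# `Balaban1983to89.B11SectFAssembly` — T. Bałaban, *The variational problem and background fields in renormalization group method
# for lattice gauge theories*, Commun. Math. Phys. **102** (1985) 277–309 [Balaban1985Variational], **Sect. F (pp. 300–305) ASSEMBLED**:
# the one-step conclusion *"U_k belongs to the space (2) with max{B₃ε₁, ½ε₀} instead of ε₀"* (the located hypothesis `HalvingStep` of the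
# gen-7 Proposition-8 assembly) and the regularity conclusion (9), (10) (the typed `B11.SectFPrinted`) DERIVED over the Theorem-1 carrier
# from the located display leaves of Sect. F; hence **Theorem 1 ⇐ Proposition 7 ∧ the leaves of Sect. F**

statement-level skeleton of published theorems with citation tags; proofs where landed; nothing here is a claim about the Yang–Mills mass gap

PDF held: `paper:balaban1985-cmp102-variational-background` (journal page = PDF page + 276); pp. 300–305 [PDF 24–29] read by this seat from
`lit read` text and from the page renders `…/b2b-balaban-ref1/pages/1985-cmp102-variational-background/…-p027-x2.png, …-p028-x2.png`.

CITATION HEADER (lean-in-tree rule 2026-08-18).  WHAT IS REPRODUCED: SKELETON rows (reader r08 `ROWS-B11.md`) **B11.Prop8** (decl of record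
`B11.Prop8Printed B₃ fam`; gen-7 assembly `B11Prop8Assembly.prop8Printed_of_halvingStep` from the located hypothesis `HalvingStep`),
**B11.Eq169 / B11.SectF** (`B11.SectFPrinted B₃ fam`, the Sect. F input `hF` of `B11.thm1_of_prop7_prop8_sectF` and of
`B11Prop8Assembly.thm1Printed_of_step`), **B11.Thm1**, and the Sect. F rows B11.Eq144–Eq168 whose displayed statements are the leaves.
References of the paper used: [6] = [Balaban1985RegularSpaces] (Theorem 2 (1.33)–(1.36) pp. 82–83; (1.54) p. 85 in the printed form
(1.141)–(1.142) p. 100 — cf. `B8Ineq1141SectG`; the Hölder vocabulary `B11Holder9.HolderClause`/`B4`).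

THE PRINT.  p. 300 [PDF 24]: *"In this section we will prove all the regularity properties of minimal configurations U_k. We will use only the
fact that they are critical configurations of the functional (5) and that they belong to the spaces (6) with ε₀ sufficiently small.  Let us
take a cube □ intersecting Ω_j but not Ω_{j+1}, of a size 2MLʲη. We are interested in two cases. To prove that U_k is in the space (8) we will
take M = R₁M₁. To prove the regularity properties (9), (10) we will admit more general M, depending on ε₁. In both cases M ≧ R₁M₁ and we
assume that M is a multiple of R₁M₁, i.e. M = M′R₁M₁, M′ is an integer."*  p. 304 [PDF 28]: (165) *"|A|, |∇^ηA|, |∂^{η*}∂^ηA|, |Δ^ηA| <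
¼M_Δmax{B₃ε₁, ½ε₀} + B₀C₄(36dL²B₁Mε₀)² + B₀4C₂(36dL²B₁Mε₀)² ≦ ¼M_Δmax{B₃ε₁, ½ε₀} + B₀(C₄ + 4C₂)(36dL²B₁R₁M₁)²(M′ε₀)², (165) where M′ = 1
in the first case, where □ is a cube of the size R₁M₁ containing Δ₀, and M′ = (R₁M₁)⁻¹M in the second case. We take a largest absolute
number a₅ such that M′ε₀ ≦ a₅ implies all the previous restrictions on ε₀, and such that B₀(C₄ + 4C₂)(36dL²B₁R₁M₁)²a₅ ≦ ⅛. (166) If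
M′ε₀ ≦ a₅, then we get |A|, |∇^ηA|, |∂^{η*}∂^ηA|, |Δ^ηA| < ¼M_Δmax{B₃ε₁, ½ε₀} + ⅛M′ε₀ on Δ. (167)  Now let us draw conclusions concerning
the regularity of U′_k from the above inequality. We take Δ = Δ₀, hence M_Δ = 1, M′ = 1, and we have this inequality with ε′ = ½max{B₃ε₁,
½ε₀} on the right-hand side. This and the inequality (1.54) of [6] imply |D^{η*}_{U₁}∂U₁| < ε′ + 86dε′² < 2ε′ on Δ₀ (168) for ε′ small,
similarly for |∂U₁ − 1|. Again using the fact that U₁ is a gauge transformed U′_k on Δ₀, and that the conditions (2) are gauge invariant,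
we conclude that U′_k satisfies (2) on Δ₀ with max{B₃ε₁, ½ε₀} instead of ε₀. The cube Δ₀ is an arbitrary cube Δ(y) = Bʲ(y), if y ∈ Λ_j,
hence U_k belongs to the space (2) with max{B₃ε₁, ½ε₀} instead of ε₀."*  pp. 304–305: *"Let us consider the second case, i.e. Δ = □ with a
size M. We may take advantage of the fact that we have proved the regularity property (8), thus we take ε₀ = B₃ε₁. Assuming M′B₃ε₁ ≦ a₅, we
get from the inequality (167), (the left-hand side of (167)) < ¼MB₃ε₁ + ⅛M′B₃ε₁ < ½MB₃ε₁. (169) The condition M′ε₁ ≦ a₁ implies M′B₃ε₁ ≦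
a₅, hence we have proved the regularity conditions (9), (10), and the proof of Theorem 1 is completed."*

WHAT IS CERTIFIED (kernel, sorry-free; axioms `propext` / `Classical.choice` / `Quot.sound`).
§1 `tinv` ((Lʲη)⁻¹ of a cube), `CubeData` (the per-cube numeric observables of the first case that the carrier `B11.VarProblemX` does not
   carry: the three scaled norms on the central unit cube Δ₀(□) and the two (2)-deviations there — DATA), `Leaves` (the located leaves as a
   hypothesis structure, field by field a displayed statement, see its docstring: (152)∧(165) on □, (165) on Δ₀, [6] (1.141)–(1.142) at
   the background 1, the locality of (2), [6] Thm 2 (1.36) on □̃, plus L, η > 0 and *"M ≧ R₁M₁"*).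
§2 first case: `a5` (the printed *"largest absolute number a₅"* made explicit), **`firstCase_arith`** ((165) ⇒ (167) with ε′ ⇒ both [6]-bounds
   below the radius max{B₃ε₁, ½ε₀}), **`halvingStep_of_leaves : Leaves P … → HalvingStep P B₃ a₅`** (the gen-7 located hypothesis
   DISCHARGED from the leaves; case B₃ε₁ ≥ ε₀ by the monotonicity of the spaces (2)), `prop8Printed_of_leaves`.
§3 second case: `a1F` (the printed *"a₁ as a largest constant such, that …"* for the Sect. F restrictions), `threshold_of_M_le`,
   **`regularity_of_leaves`** ((165) at ε₀ = B₃ε₁, M_Δ = M ⇒ (166) ⇒ (169) < ½MB₃ε₁ ≤ B₃Mε₁, Hölder clause via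
   `B11Holder9.holder9_of_thm2_136` with B₄ = `B11Holder9.B4` = 9dL²B₂B₃ ⇒ `B11.Regularity`), **`sectFPrinted_of_leaves :
   (∀ i, Leaves (fam i) …) → B11.SectFPrinted B₃ fam`** with M(ε₁) = R₁M₁(a₁/ε₁) as printed (p. 279).
§4 **`thm1Printed_of_prop7_leaves : (∀ i, (fam i).Laws) → B11.Prop7Printed B₃ C₁ fam → (∀ i, Leaves (fam i) …) → B11.Thm1Printed …`**
   (by name through `B11Prop8Assembly.thm1Printed_of_step`).
With this file the paper-internal DAG of [Balaban1985Variational] is kernel-assembled as Thm 1 ⇐ {Prop 7 (gen 7: ⇐ Prop 2 ⇐ [6] Thm 2,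
Prop 5, Prop 6), the located leaves of Sect. F}; the numeric chain (161) ⇒ (164) ⇒ (165) ⇒ (167) ⇒ (168)/(169) behind the leaf (165) is the
sibling `B11Eq161HBChain` (this seat, p263534).  NON-VACUITY: `Leaves` is inhabited non-trivially by a one-amplitude toy model (scratch
`HOME/lit-balaban-r08/lean/scratch-LeavesF-nonvacuity-g8.lean`, rc 0; not filed).

LOCATED GAP (cell GAPS.md **G-B11-02**, filed by this seat).  The first case is assembled with the REPAIRED (166′) K·a₅ ≤ 1/16 in place of the
printed ⅛ (`a5`): with ⅛, the (167)-bound e₁ = ¼max{B₃ε₁, ½ε₀} + Kε₀² of the three norms on Δ₀ equals ε′ = ½max{B₃ε₁, ½ε₀} in the regime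
B₃ε₁ ≦ ½ε₀, and [6] (1.141) at α₀ = 0 then bounds the plaquette deviation only by (2e₁ + 8e₁²) = max{B₃ε₁, ½ε₀} + 8ε′² — the words
*"similarly for |∂U₁ − 1|"* miss the radius max{B₃ε₁, ½ε₀} by the second-order term (the D*∂U₁ half (168) is fine: 86 = 36 + 50 from (1.142)).
With 1/16 one has e₁ ≤ ¾ε′ and both deviations are < max{B₃ε₁, ½ε₀} for max{B₃ε₁, ½ε₀} ≤ 1/(20d) (`firstCase_arith`); a₅ halves, nothing
else changes.  Kernel evidence: `firstCase_arith` (repaired) and `B11Eq161HBChain` v1.1 (witness for the printed ⅛).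

HONEST SCOPE — what is NOT proved here: every field of `Leaves` (the lattice-level content of Sect. F and of [6]: the existence of the Landau
gauge (152) on □̃, the solution A₁ of (158) with the bounds (165), the estimates (1.141)–(1.142)/(1.54) of [6], the locality and gauge
invariance of (2), the Hölder bound (1.36) — at β₀ = 1, where [6] prints β₀ < 1: cell GAPS G-B11-F3 —, and the class property M ≧ R₁M₁);
Proposition 7; the dictionary `VarProblemX.Laws`.  No new named fact (`Leaves` is a hypothesis structure; `CubeData` is data; `tinv`, `a5`,
`a1F` are definitions with bodies).  Mega-formalization `lit-balaban`, HOME `run/shared/lean/pub/lit-balaban/`, reader/typer seat r08 gen 8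
(unit `lit-balaban-r08`, B11 fold owner).  Imports `B11Prop8Assembly`, `B11Holder9`, `B11Smallness`; modifies nothing there.
-/

namespace Literature.MathematicalPhysics.QuantumFieldTheory.Balaban1983to89.B11SectFAssembly

open Literature.MathematicalPhysics.QuantumFieldTheory.Balaban1983to89
open B11 B11Prop8Assembly B11Holder9

variable {I : Type}

/-! ## §1 The located leaves of Sect. F over the Theorem-1 carrier -/

/-- The inverse block length (Lʲη)⁻¹ of a cube □ of scale j (the unit in which (9), (10), (152), (165) are written; in Sect. F
*"we assume that j = k, a general case can be obtained by obvious rescalings"*, p. 300). [cite: Balaban1985Variational, (9)–(10) p.279] -/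
noncomputable def tinv (P : VarProblemX) (c : P.Cube) : ℝ := (P.L ^ P.scale c * P.eta)⁻¹

/-- **Per-cube numeric data of Sect. F not carried by the Theorem-1 carrier** `B11.VarProblemX` (whose `normA`, `normGradA`,
`normLapA`, `holderA` are the sup-norms on the WHOLE cube □ of the gauge-fixed A, U^{u⁻¹} = e^{iηA}, of `Gauged U □`): for the
first case of Sect. F (p. 302: *"for a plaquette p, or a bond b, we take a unit cube Δ₀ ⊂ Bʲ(Λ_j) containing p or b. The cube Δ₀ is
contained in a big cube of the size 2R₁M₁Lʲη and we take □ as this big cube"*; p. 303 *"i.e., Δ₀ = Bᵏ(y)"*) the three scaled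
sup-norms of the same A over the central unit cube Δ₀(□) ⊂ □ (`normA0`, `normGradA0`, `normLapA0`), and the two (2)-deviations of U over
Δ₀(□) in the units of (2) p. 278 (`plaqDev U □` = sup_{p⊂Δ₀} η⁻²(Lʲη)²|U(∂p) − 1|, `dstarDev U □` = sup_{b∈Δ₀} η⁻²(Lʲη)³|(D*_U∂U)(b)|;
gauge invariant, p. 304 *"the conditions (2) are gauge invariant"*).  Data only; the located statements about them are `Leaves`.
[cite: Balaban1985Variational, (2) p.278, Sect. F pp.302–304] -/
structure CubeData (P : VarProblemX) where
  normA0 : P.Cfg → P.Cube → ℝ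
  normGradA0 : P.Cfg → P.Cube → ℝ
  normLapA0 : P.Cfg → P.Cube → ℝ
  plaqDev : P.Cfg → P.Cube → ℝ
  dstarDev : P.Cfg → P.Cube → ℝ

/-- **The located leaves of Sect. F** (pp. 300–305 [PDF 24–29]) as hypotheses over the Theorem-1 carrier — each field a displayed
statement of the paper or of [6], read at the scale unit `tinv` of the cube, NEVER asserted here (their lattice kernels are the rows
B11.Eq144–Eq169 of the cell: (152) `B11Holder9`, (155) `B11Eq155BlockLog`, (158) `B11Prop6Scheme.eq158_solution`, (160)
`B11Eq160BondField`, (161)–(169) `B11Eq161HBChain`/`B11B3`/`B11Smallness`, (1.141)–(1.142) of [6] `B8Ineq1141SectG`).  Constants: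
d, L; B₁ ([6] Thm 2), B₂ = B₂(β₀) ([6] (1.36)), B₃ ((162)), K = B₀(C₄ + 4C₂)(36dL²B₁R₁M₁)² ((165)–(166)), R₁M₁ ((144)), c₁ ([6] Thm 2:
*"We assume that 9dL²Mε₀ ≦ c₁"* p. 301), a₃ (Prop. 4: *"We have to assume that 36dL²B₁Mε₀ ≦ a₃"* p. 302), a₄ (Prop. 6: *"we assume that
40dL²B₁Mε₀ ≦ a₄"* p. 302).
* `L_pos`, `eta_pos`: L, η > 0 (p. 278: η = L⁻ᵏ, L a positive integer); `size_ge`: p. 300 *"In both cases M ≧ R₁M₁"* for the cubes of the class.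
* `reg165` — **(152) ∧ (165) for Δ = □** (second case, M_Δ = M, M′ = M/(R₁M₁)): for U critical in 𝔘_k(ε₀) ∩ 𝔅_k(V), V with (7), under the
  three displayed restrictions, the gauge u of (152) exists on □ (`Gauged`) and *"|A|, |∇^ηA|, |∂^{η*}∂^ηA|, |Δ^ηA| < ¼M_Δmax{B₃ε₁, ½ε₀} +
  B₀(C₄ + 4C₂)(36dL²B₁R₁M₁)²(M′ε₀)²"* (165) on □.
* `reg165_unit` — **(165) for Δ = Δ₀** (first case, M_Δ = 1) for the same A on the central unit cube of □.
* `dev1142` — **[6] (1.141)–(1.142) at the background 1** (α₀ = 0) for U₁ = U^{u⁻¹} = e^{iηA} on Δ₀, p. 304 *"This and the inequality (1.54)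
  of [6] imply |D^{η*}_{U₁}∂U₁| < ε′ + 86dε′² …"*; [6] p. 100: *"|(U₁U₀)(∂p) − 1| … < (α₀ + 2α₂ + 8α₂²)L^{−2j}"* (1.141), *"|D^{η*}_{U₁U₀}∂U₁U₀| <
  (α₀ + α₂ + 36dα₂² + 50dα₂³ + 10dα₀α₂)(Lʲη)⁻³η²"* (1.142), with α₂ = e the common bound of the three scaled norms on Δ₀ (e ≤ 1), the
  deviations being gauge invariant.
* `inU_local` — **locality of (2)**, p. 304: *"we conclude that U′_k satisfies (2) on Δ₀ with max{B₃ε₁, ½ε₀} instead of ε₀. The cube Δ₀ is an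
  arbitrary cube Δ(y) = Bʲ(y), if y ∈ Λ_j, hence U_k belongs to the space (2) with max{B₃ε₁, ½ε₀} instead of ε₀"*: U ∈ 𝔘_k(r) as soon as both
  deviations are < r on the central unit cube of every class cube of size R₁M₁.
* `holder136` — **[6] Theorem 2 (1.36) on □̃ at the data (150)–(151)** (α₀ = ε₀, α₁ = 9dL²Mε₀ − ε₀), the Hölder companion of (152) in the
  shape `B11Holder9.HolderClause` at β₀ = 1 — the input of the Hölder clause of (9) that the paper does not derive (cell GAPS G-B11-F3:
  [6] (1.36) is printed for β ≦ β₀ < 1; typed reading β₀ = 1 of `B11.Regularity`).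
[cite: Balaban1985Variational, Sect. F (144)–(169) pp.300–305; Balaban1985RegularSpaces, Thm 2 (1.36) p.82, (1.141)–(1.142) p.100] -/
structure Leaves (P : VarProblemX) (D : CubeData P) (d L B₁ B₂ B₃ K R₁M₁ c₁ a₃ a₄ : ℝ) : Prop where
  L_pos : 0 < P.L
  eta_pos : 0 < P.eta
  size_ge : ∀ c : P.Cube, R₁M₁ ≤ P.sizeM c
  reg165 : ∀ (ε₀ ε₁ : ℝ) (V : P.Bdry) (U : P.Cfg) (c : P.Cube), 0 < ε₁ → P.Reg7 ε₁ V → P.InU ε₀ U → P.InB V U →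
    P.IsCritical V U → 9 * d * L ^ 2 * P.sizeM c * ε₀ ≤ c₁ → 36 * d * L ^ 2 * B₁ * P.sizeM c * ε₀ ≤ a₃ →
    40 * d * L ^ 2 * B₁ * P.sizeM c * ε₀ ≤ a₄ →
    P.Gauged U c ∧
    P.normA U c < (1 / 4 * P.sizeM c * max (B₃ * ε₁) (ε₀ / 2) + K * (P.sizeM c / R₁M₁ * ε₀) ^ 2) * tinv P c ^ 1 ∧
    P.normGradA U c < (1 / 4 * P.sizeM c * max (B₃ * ε₁) (ε₀ / 2) + K * (P.sizeM c / R₁M₁ * ε₀) ^ 2) * tinv P c ^ 2 ∧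
    P.normLapA U c < (1 / 4 * P.sizeM c * max (B₃ * ε₁) (ε₀ / 2) + K * (P.sizeM c / R₁M₁ * ε₀) ^ 2) * tinv P c ^ 3
  reg165_unit : ∀ (ε₀ ε₁ : ℝ) (V : P.Bdry) (U : P.Cfg) (c : P.Cube), 0 < ε₁ → P.Reg7 ε₁ V → P.InU ε₀ U → P.InB V U →
    P.IsCritical V U → 9 * d * L ^ 2 * P.sizeM c * ε₀ ≤ c₁ → 36 * d * L ^ 2 * B₁ * P.sizeM c * ε₀ ≤ a₃ →
    40 * d * L ^ 2 * B₁ * P.sizeM c * ε₀ ≤ a₄ →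
    D.normA0 U c < (1 / 4 * max (B₃ * ε₁) (ε₀ / 2) + K * (P.sizeM c / R₁M₁ * ε₀) ^ 2) * tinv P c ^ 1 ∧
    D.normGradA0 U c < (1 / 4 * max (B₃ * ε₁) (ε₀ / 2) + K * (P.sizeM c / R₁M₁ * ε₀) ^ 2) * tinv P c ^ 2 ∧
    D.normLapA0 U c < (1 / 4 * max (B₃ * ε₁) (ε₀ / 2) + K * (P.sizeM c / R₁M₁ * ε₀) ^ 2) * tinv P c ^ 3
  dev1142 : ∀ (U : P.Cfg) (c : P.Cube) (e : ℝ), P.Gauged U c → 0 < e → e ≤ 1 →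
    D.normA0 U c < e * tinv P c ^ 1 → D.normGradA0 U c < e * tinv P c ^ 2 → D.normLapA0 U c < e * tinv P c ^ 3 →
    D.plaqDev U c < 2 * e + 8 * e ^ 2 ∧ D.dstarDev U c < e + 36 * d * e ^ 2 + 50 * d * e ^ 3
  inU_local : ∀ (r : ℝ) (U : P.Cfg), 0 < r →
    (∀ c : P.Cube, P.sizeM c = R₁M₁ → D.plaqDev U c < r ∧ D.dstarDev U c < r) → P.InU r U
  holder136 : ∀ (ε₀ ε₁ : ℝ) (V : P.Bdry) (U : P.Cfg) (c : P.Cube), 0 < ε₁ → P.Reg7 ε₁ V → P.InU ε₀ U → P.InB V U →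
    P.IsCritical V U → 9 * d * L ^ 2 * P.sizeM c * ε₀ ≤ c₁ →
    HolderClause (P.holderA U c) 1 (B₂ * (ε₀ + (9 * d * L ^ 2 * P.sizeM c * ε₀ - ε₀))) (tinv P c)

/-! ## §2 The first case: the halving step (Prop. 8's located hypothesis) from the leaves -/

/-- **a₅ of (166)** — *"We take a largest absolute number a₅ such that M′ε₀ ≦ a₅ implies all the previous restrictions on ε₀, and such
that B₀(C₄ + 4C₂)(36dL²B₁R₁M₁)²a₅ ≦ ⅛"* (p. 304) — for the first case (M = R₁M₁, M′ = 1) made explicit: the three displayed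
restrictions at M = R₁M₁, the REPAIRED (166′) `K·a₅ ≤ 1/16` (cell GAPS G-B11-02: with the printed ⅛ the plaquette half of (168),
*"similarly for |∂U₁ − 1|"*, misses the radius max{B₃ε₁, ½ε₀} by the second-order term of [6] (1.141); 1/16 restores it), and the
smallness `a₅ ≤ 1/(20d)` behind *"for ε′ small"* in (168). [cite: Balaban1985Variational, (166) p.304] -/
noncomputable def a5 (d L B₁ K R₁M₁ c₁ a₃ a₄ : ℝ) : ℝ :=
  min (min (c₁ / (9 * d * L ^ 2 * R₁M₁)) (min (a₃ / (36 * d * L ^ 2 * B₁ * R₁M₁)) (a₄ / (40 * d * L ^ 2 * B₁ * R₁M₁))))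
    (min (1 / (16 * K)) (1 / (20 * d)))

section FirstCase

variable {P : VarProblemX} {D : CubeData P} {d L B₁ B₂ B₃ K R₁M₁ c₁ a₃ a₄ : ℝ}

/-- a₅ > 0 for positive constants. [cite: Balaban1985Variational, (166) p.304] -/
theorem a5_pos (hd : 0 < d) (hL : 0 < L) (hB₁ : 0 < B₁) (hK : 0 < K) (hR : 0 < R₁M₁) (hc₁ : 0 < c₁) (ha₃ : 0 < a₃)
    (ha₄ : 0 < a₄) : 0 < a5 d L B₁ K R₁M₁ c₁ a₃ a₄ := by
  unfold a5
  refine lt_min (lt_min ?_ (lt_min ?_ ?_)) (lt_min ?_ ?_) <;> positivity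

/-- The arithmetic of the first case with the repaired (166′): if `m = max{B₃ε₁, ½ε₀}` with `0 < ε₀ ≤ 2m`, `Kε₀² ≤ ε₀/16`,
`m ≤ 1/(20d)`, `d ≥ 1`, then for `e₁ = ¼m + Kε₀²`: `0 < e₁ ≤ 1` and the two [6]-bounds are below the radius `m`:
`2e₁ + 8e₁² < m` and `e₁ + 36de₁² + 50de₁³ < m`. [cite: Balaban1985Variational, (165)–(168) p.304] -/
theorem firstCase_arith {m ε₀ e₁ : ℝ} (hd : 1 ≤ d) (hε₀ : 0 < ε₀) (hm2 : ε₀ ≤ 2 * m)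
    (hK0 : 0 ≤ K) (hK : K * ε₀ ^ 2 ≤ ε₀ / 16) (hsmall : m ≤ 1 / (20 * d)) (he₁ : e₁ = 1 / 4 * m + K * ε₀ ^ 2) :
    0 < e₁ ∧ e₁ ≤ 1 ∧ 2 * e₁ + 8 * e₁ ^ 2 < m ∧ e₁ + 36 * d * e₁ ^ 2 + 50 * d * e₁ ^ 3 < m := by
  have hm0 : 0 < m := by linarith
  have hd0 : 0 < d := by linarith
  have he₁le : e₁ ≤ 3 / 8 * m := by rw [he₁]; nlinarith
  have he₁pos : 0 < e₁ := by rw [he₁]; nlinarith [sq_nonneg ε₀]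
  have hdm : d * m ≤ 1 / 20 := by
    have := (le_div_iff₀ (by positivity : (0 : ℝ) < 20 * d)).mp hsmall
    linarith
  have hm1 : m ≤ 1 / 20 := by
    have : m * 1 ≤ m * d := mul_le_mul_of_nonneg_left hd hm0.le
    linarith
  have he₁1 : e₁ ≤ 1 := by linarith
  refine ⟨he₁pos, he₁1, ?_, ?_⟩
  · -- 2e₁ + 8e₁² ≤ ¾m + (9/8)m² < m  (m < 2/9)
    nlinarith [sq_nonneg e₁, mul_pos he₁pos hm0]
  · -- e₁ + 36de₁² + 50de₁³ ≤ e₁(1 + 86de₁) ≤ ⅜m(1 + (129/4)dm) < m  (dm ≤ 1/20)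
    have h3 : e₁ ^ 3 ≤ e₁ ^ 2 := by nlinarith [sq_nonneg e₁]
    have h4 : 36 * d * e₁ ^ 2 + 50 * d * e₁ ^ 3 ≤ 86 * d * e₁ ^ 2 := by nlinarith
    have h5 : d * e₁ ≤ 3 / 8 * (d * m) := by nlinarith
    have h6 : 86 * d * e₁ ^ 2 ≤ 86 * (3 / 8 * (1 / 20)) * e₁ := by nlinarith
    nlinarith

/-- **The halving step from the leaves** (Sect. F first case, pp. 302–304, with the repaired (166′) of cell GAPS G-B11-02): for V with (7)
and U critical in 𝔘_k(ε₀) ∩ 𝔅_k(V) with ε₀ ≤ a₅, U ∈ 𝔘_k(max{B₃ε₁, ½ε₀}) — by monotonicity of the spaces (2) if B₃ε₁ ≥ ε₀, and otherwise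
through (165) on Δ₀ ⇒ (167) with ε′ ⇒ [6] (1.141)–(1.142) ⇒ (168) on every Δ₀ ⇒ locality of (2).  This DISCHARGES the located hypothesis
`B11Prop8Assembly.HalvingStep P B₃ a₅` of the gen-7 assembly. [cite: Balaban1985Variational, Sect. F pp.302–304 + Prop. 8 p.304] -/
theorem halvingStep_of_leaves (hLv : Leaves P D d L B₁ B₂ B₃ K R₁M₁ c₁ a₃ a₄) (hd : 1 ≤ d) (hL : 0 < L) (hB₁ : 0 < B₁)
    (hB₃ : 0 < B₃) (hK : 0 < K) (hR : 0 < R₁M₁)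
    (mono : ∀ (e e' : ℝ) (U : P.Cfg), e ≤ e' → P.InU e U → P.InU e' U) :
    HalvingStep P B₃ (a5 d L B₁ K R₁M₁ c₁ a₃ a₄) := by
  refine ⟨fun ε₀ ε₁ V U hε₁ hV hU hB hcrit hε₀ => ?_⟩
  set m : ℝ := max (B₃ * ε₁) (ε₀ / 2) with hm
  rcases le_or_gt ε₀ (B₃ * ε₁) with hcase | hcase
  · -- «If ½ε₀ ≦ B₃ε₁ …»: here even ε₀ ≤ B₃ε₁, monotonicity of the spaces (2)
    exact mono _ _ U (hcase.trans (le_max_left _ _)) hU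
  · -- the first case proper: 0 < B₃ε₁ < ε₀ ≤ a₅
    have hd0 : 0 < d := by linarith
    have hε₀pos : 0 < ε₀ := lt_trans (mul_pos hB₃ hε₁) hcase
    have hmε : m ≤ ε₀ := max_le hcase.le (by linarith)
    have hm2 : ε₀ ≤ 2 * m := by linarith [le_max_right (B₃ * ε₁) (ε₀ / 2)]
    have hm0 : 0 < m := by linarith
    -- the restrictions folded into a₅
    have ha5 := hε₀
    unfold a5 at ha5
    simp only [le_min_iff] at ha5
    obtain ⟨⟨h1, h2, h3⟩, h4, h5⟩ := ha5
    have hden1 : 0 < 9 * d * L ^ 2 * R₁M₁ := by positivity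
    have hden2 : 0 < 36 * d * L ^ 2 * B₁ * R₁M₁ := by positivity
    have hden3 : 0 < 40 * d * L ^ 2 * B₁ * R₁M₁ := by positivity
    have hK16 : K * ε₀ ^ 2 ≤ ε₀ / 16 := by
      have hKε : K * ε₀ ≤ 1 / 16 := by
        have := (le_div_iff₀ (by positivity : (0 : ℝ) < 16 * K)).mp h4
        nlinarith
      nlinarith
    have hsmall : m ≤ 1 / (20 * d) := hmε.trans h5
    refine hLv.inU_local m U hm0 fun c hc => ?_
    -- the three displayed restrictions at M = R₁M₁
    have hr1 : 9 * d * L ^ 2 * P.sizeM c * ε₀ ≤ c₁ := by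
      rw [hc]; have := (le_div_iff₀ hden1).mp h1; linarith
    have hr2 : 36 * d * L ^ 2 * B₁ * P.sizeM c * ε₀ ≤ a₃ := by
      rw [hc]; have := (le_div_iff₀ hden2).mp h2; linarith
    have hr3 : 40 * d * L ^ 2 * B₁ * P.sizeM c * ε₀ ≤ a₄ := by
      rw [hc]; have := (le_div_iff₀ hden3).mp h3; linarith
    obtain ⟨hG, -, -, -⟩ := hLv.reg165 ε₀ ε₁ V U c hε₁ hV hU hB hcrit hr1 hr2 hr3
    obtain ⟨hn1, hn2, hn3⟩ := hLv.reg165_unit ε₀ ε₁ V U c hε₁ hV hU hB hcrit hr1 hr2 hr3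
    -- M′ = M/R₁M₁ = 1
    have hM' : P.sizeM c / R₁M₁ * ε₀ = ε₀ := by rw [hc, div_self hR.ne', one_mul]
    rw [hM'] at hn1 hn2 hn3
    set e₁ : ℝ := 1 / 4 * m + K * ε₀ ^ 2 with he₁
    obtain ⟨he0, he1, hplaq, hdst⟩ := firstCase_arith hd hε₀pos hm2 hK.le hK16 hsmall he₁
    obtain ⟨hp, hq⟩ := hLv.dev1142 U c e₁ hG he0 he1 hn1 hn2 hn3
    exact ⟨lt_trans hp hplaq, lt_trans hq hdst⟩

/-- **Proposition 8 from the leaves** (by the gen-7 iteration `B11Prop8Assembly.prop8Printed_of_halvingStep`).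
[cite: Balaban1985Variational, Prop. 8 p.304] -/
theorem prop8Printed_of_leaves (fam : I → VarProblemX) (D : ∀ i, CubeData (fam i))
    (hLv : ∀ i, Leaves (fam i) (D i) d L B₁ B₂ B₃ K R₁M₁ c₁ a₃ a₄) (hd : 1 ≤ d) (hL : 0 < L) (hB₁ : 0 < B₁)
    (hB₃ : 0 < B₃) (hK : 0 < K) (hR : 0 < R₁M₁) (hc₁ : 0 < c₁) (ha₃ : 0 < a₃) (ha₄ : 0 < a₄)
    (mono : ∀ (i : I) (e e' : ℝ) (U : (fam i).Cfg), e ≤ e' → (fam i).InU e U → (fam i).InU e' U) :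
    Prop8Printed B₃ fam :=
  prop8Printed_of_halvingStep fam hB₃ (a5_pos (by linarith) hL hB₁ hK hR hc₁ ha₃ ha₄) mono
    fun i => halvingStep_of_leaves (hLv i) hd hL hB₁ hB₃ hK hR (mono i)

end FirstCase

/-! ## §3 The second case: the regularity conclusion of Sect. F (`B11.SectFPrinted`) from the leaves -/

/-- **a₁ of the second case** (p. 304: *"Now we define a₁ as a largest constant such, that the restriction ε₁ ≦ a₁ implies all the other
restrictions we have imposed on ε₁"*; p. 305: *"The condition M′ε₁ ≦ a₁ implies M′B₃ε₁ ≦ a₅"*), made explicit for the Sect. F restrictions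
at ε₀ = B₃ε₁ and M ≦ R₁M₁(a₁/ε₁): the three displayed restrictions and (166) in the form K·B₃a₁ ≤ ⅛.
[cite: Balaban1985Variational, p.304 «Now we define a₁ …» + (169) p.305] -/
noncomputable def a1F (d L B₁ B₃ K R₁M₁ c₁ a₃ a₄ : ℝ) : ℝ :=
  min (min (c₁ / (9 * d * L ^ 2 * B₃ * R₁M₁))
      (min (a₃ / (36 * d * L ^ 2 * B₁ * B₃ * R₁M₁)) (a₄ / (40 * d * L ^ 2 * B₁ * B₃ * R₁M₁))))
    (1 / (8 * K * B₃))

section SecondCase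

variable {P : VarProblemX} {D : CubeData P} {d L B₁ B₂ B₃ K R₁M₁ c₁ a₃ a₄ : ℝ}

/-- a₁(F) > 0 for positive constants. [cite: Balaban1985Variational, p.304] -/
theorem a1F_pos (hd : 0 < d) (hL : 0 < L) (hB₁ : 0 < B₁) (hB₃ : 0 < B₃) (hK : 0 < K) (hR : 0 < R₁M₁) (hc₁ : 0 < c₁)
    (ha₃ : 0 < a₃) (ha₄ : 0 < a₄) : 0 < a1F d L B₁ B₃ K R₁M₁ c₁ a₃ a₄ := by
  unfold a1F
  refine lt_min (lt_min ?_ (lt_min ?_ ?_)) ?_ <;> positivity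

/-- The restrictions at M ≦ R₁M₁(a₁/ε₁): `κ·M·ε₁ ≤ b` from `κ·R₁M₁·a₁ ≤ b` (κ ≥ 0) — the mechanism of p. 305 *"The condition M′ε₁ ≦ a₁
implies M′B₃ε₁ ≦ a₅"* (cf. `B11Holder9.smallness152_of_M_le`). [cite: Balaban1985Variational, (169) p.305] -/
theorem threshold_of_M_le {κ M a₁ ε₁ b : ℝ} (hκ : 0 ≤ κ) (hε₁ : 0 < ε₁) (hM : M ≤ R₁M₁ * (a₁ / ε₁))
    (ha : κ * R₁M₁ * a₁ ≤ b) : κ * M * ε₁ ≤ b := by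
  have hMε : M * ε₁ ≤ R₁M₁ * a₁ := by
    calc M * ε₁ ≤ R₁M₁ * (a₁ / ε₁) * ε₁ := mul_le_mul_of_nonneg_right hM hε₁.le
      _ = R₁M₁ * a₁ := by field_simp
  calc κ * M * ε₁ = κ * (M * ε₁) := by ring
    _ ≤ κ * (R₁M₁ * a₁) := mul_le_mul_of_nonneg_left hMε hκ
    _ = κ * R₁M₁ * a₁ := by ring
    _ ≤ b := ha

/-- **The second case on one cube** (pp. 304–305): for V with (7), U critical in 𝔘_k(B₃ε₁) ∩ 𝔅_k(V) (*"thus we take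
ε₀ = B₃ε₁"*) and a class cube □ with M ≦ R₁M₁(a₁/ε₁): the restrictions hold, (165) reads < (¼M + ⅛M′)B₃ε₁ by (166) ⇒ (169) < ½MB₃ε₁ ≤
B₃Mε₁, and the Hölder companion of (152) gives the clause of (9) with B₄ = `B11Holder9.B4` — i.e. `B11.Regularity` for □.
[cite: Balaban1985Variational, (165)–(169) pp.304–305 + (9)–(10) p.279] -/
theorem regularity_of_leaves (hLv : Leaves P D d L B₁ B₂ B₃ K R₁M₁ c₁ a₃ a₄) (hd : 0 < d) (hL : 0 < L) (hB₁ : 0 < B₁)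
    (hB₃ : 0 < B₃) (hK : 0 < K) (hR : 1 ≤ R₁M₁) {ε₁ : ℝ} {V : P.Bdry} {U : P.Cfg} (hε₁ : 0 < ε₁)
    (hV : P.Reg7 ε₁ V) (hU : P.InU (B₃ * ε₁) U) (hB : P.InB V U)
    (hcrit : P.IsCritical V U) (c : P.Cube) (hMc : P.sizeM c ≤ R₁M₁ * (a1F d L B₁ B₃ K R₁M₁ c₁ a₃ a₄ / ε₁)) :
    Regularity P.toVarProblem B₃ (B4 d L B₂ B₃) ε₁ U c := by
  set a₁ := a1F d L B₁ B₃ K R₁M₁ c₁ a₃ a₄ with ha₁def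
  have hR0 : 0 < R₁M₁ := by linarith
  have ha₁ : a₁ ≤ c₁ / (9 * d * L ^ 2 * B₃ * R₁M₁) ∧ a₁ ≤ a₃ / (36 * d * L ^ 2 * B₁ * B₃ * R₁M₁) ∧
      a₁ ≤ a₄ / (40 * d * L ^ 2 * B₁ * B₃ * R₁M₁) ∧ a₁ ≤ 1 / (8 * K * B₃) := by
    refine ⟨?_, ?_, ?_, ?_⟩ <;> simp only [ha₁def, a1F, min_le_iff, le_refl, true_or, or_true]
  obtain ⟨h1, h2, h3, h4⟩ := ha₁
  set M := P.sizeM c with hMdef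
  have hMR : R₁M₁ ≤ M := hLv.size_ge c
  have hM0 : 0 < M := lt_of_lt_of_le hR0 hMR
  have hMε : M ≤ R₁M₁ * (a₁ / ε₁) := hMc
  -- the three displayed restrictions at ε₀ = B₃ε₁
  have hr1 : 9 * d * L ^ 2 * M * (B₃ * ε₁) ≤ c₁ := by
    have h := (le_div_iff₀ (by positivity : (0:ℝ) < 9 * d * L ^ 2 * B₃ * R₁M₁)).mp h1
    have := threshold_of_M_le (κ := 9 * d * L ^ 2 * B₃) (b := c₁) (by positivity) hε₁ hMε (by linarith)
    linarith
  have hr2 : 36 * d * L ^ 2 * B₁ * M * (B₃ * ε₁) ≤ a₃ := by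
    have h := (le_div_iff₀ (by positivity : (0:ℝ) < 36 * d * L ^ 2 * B₁ * B₃ * R₁M₁)).mp h2
    have := threshold_of_M_le (κ := 36 * d * L ^ 2 * B₁ * B₃) (b := a₃) (by positivity) hε₁ hMε (by linarith)
    linarith
  have hr3 : 40 * d * L ^ 2 * B₁ * M * (B₃ * ε₁) ≤ a₄ := by
    have h := (le_div_iff₀ (by positivity : (0:ℝ) < 40 * d * L ^ 2 * B₁ * B₃ * R₁M₁)).mp h3
    have := threshold_of_M_le (κ := 40 * d * L ^ 2 * B₁ * B₃) (b := a₄) (by positivity) hε₁ hMε (by linarith)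
    linarith
  obtain ⟨hG, hnA, hnG, hnL⟩ := hLv.reg165 (B₃ * ε₁) ε₁ V U c hε₁ hV hU hB hcrit hr1 hr2 hr3
  have hH := hLv.holder136 (B₃ * ε₁) ε₁ V U c hε₁ hV hU hB hcrit hr1
  -- «thus we take ε₀ = B₃ε₁»: max{B₃ε₁, ½B₃ε₁} = B₃ε₁
  have hB₃ε : 0 < B₃ * ε₁ := mul_pos hB₃ hε₁
  have hmax : max (B₃ * ε₁) (B₃ * ε₁ / 2) = B₃ * ε₁ := max_eq_left (by linarith)
  rw [hmax] at hnA hnG hnL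
  -- (166): K(M′B₃ε₁)² ≤ ⅛M′B₃ε₁, M′ = M/R₁M₁, via M′ε₁ ≤ a₁ ≤ 1/(8KB₃)
  set M' := M / R₁M₁ with hM'def
  have hM'0 : 0 ≤ M' := div_nonneg hM0.le hR0.le
  have hM'le : M' ≤ M := by
    rw [hM'def]; exact div_le_self hM0.le hR
  have hM'ε : M' * ε₁ ≤ a₁ := by
    have : M' ≤ a₁ / ε₁ := by
      rw [hM'def, div_le_iff₀ hR0]; linarith
    calc M' * ε₁ ≤ a₁ / ε₁ * ε₁ := mul_le_mul_of_nonneg_right this hε₁.le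
      _ = a₁ := by field_simp
  have hKx : K * (M' * (B₃ * ε₁)) ^ 2 ≤ 1 / 8 * (M' * (B₃ * ε₁)) := by
    have hKB : K * B₃ * a₁ ≤ 1 / 8 := by
      have := (le_div_iff₀ (by positivity : (0:ℝ) < 8 * K * B₃)).mp h4
      linarith
    have hx0 : 0 ≤ M' * (B₃ * ε₁) := by positivity
    have hKxle : K * (M' * (B₃ * ε₁)) ≤ 1 / 8 := by
      calc K * (M' * (B₃ * ε₁)) = K * B₃ * (M' * ε₁) := by ring
        _ ≤ K * B₃ * a₁ := mul_le_mul_of_nonneg_left hM'ε (by positivity)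
        _ ≤ 1 / 8 := hKB
    nlinarith
  -- (169): (¼M + ⅛M′)B₃ε₁ < ½MB₃ε₁ ≤ B₃Mε₁
  have hX : 1 / 4 * M * (B₃ * ε₁) + K * (M / R₁M₁ * (B₃ * ε₁)) ^ 2 ≤ B₃ * M * ε₁ := by
    have : 1 / 4 * M * (B₃ * ε₁) + 1 / 8 * (M' * (B₃ * ε₁)) ≤ B₃ * M * ε₁ := by nlinarith
    rw [← hM'def]; linarith
  have ht : 0 < tinv P c := by
    unfold tinv; exact inv_pos.mpr (mul_pos (pow_pos hLv.L_pos _) hLv.eta_pos)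
  refine ⟨hG, ?_, ?_, ?_, ?_⟩
  · exact lt_of_lt_of_le hnA (mul_le_mul_of_nonneg_right hX (pow_pos ht 1).le)
  · exact lt_of_lt_of_le hnG (mul_le_mul_of_nonneg_right hX (pow_pos ht 2).le)
  · -- the Hölder clause of (9) with B₄ = 9dL²B₂B₃ (`B11Holder9.holder9_of_thm2_136`)
    exact holder9_of_thm2_136 (β₀ := 1) (α₀ := B₃ * ε₁) (α₁ := 9 * d * L ^ 2 * M * (B₃ * ε₁) - B₃ * ε₁)
      (ε₀ := B₃ * ε₁) hH rfl rfl rfl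
  · exact lt_of_lt_of_le hnL (mul_le_mul_of_nonneg_right hX (pow_pos ht 3).le)

/-- **The regularity conclusion of Sect. F from the leaves**: the typed `B11.SectFPrinted B₃ fam` (the Theorem-1 input of
`B11.thm1_of_prop7_prop8_sectF`) holds with a₁ = `a1F`, B₄ = `B11Holder9.B4 d L B₂ B₃` = 9dL²B₂B₃ and M(ε₁) = R₁M₁(a₁/ε₁) (p. 279: *"More
exactly M(ε₁) = R₁M₁(a₁/ε₁)"*).  DISCHARGES the located hypothesis `hF` of the gen-7 assemblies.
[cite: Balaban1985Variational, Sect. F (169) p.305 + Thm 1 (9)–(10) p.279] -/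
theorem sectFPrinted_of_leaves (fam : I → VarProblemX) (D : ∀ i, CubeData (fam i))
    (hLv : ∀ i, Leaves (fam i) (D i) d L B₁ B₂ B₃ K R₁M₁ c₁ a₃ a₄) (hd : 0 < d) (hL : 0 < L) (hB₁ : 0 < B₁)
    (hB₂ : 0 < B₂) (hB₃ : 0 < B₃) (hK : 0 < K) (hR : 1 ≤ R₁M₁) (hc₁ : 0 < c₁) (ha₃ : 0 < a₃) (ha₄ : 0 < a₄) :
    SectFPrinted B₃ fam := by
  refine ⟨a1F d L B₁ B₃ K R₁M₁ c₁ a₃ a₄, B4 d L B₂ B₃, R₁M₁, a1F_pos hd hL hB₁ hB₃ hK (by linarith) hc₁ ha₃ ha₄,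
    B4_pos hd hL hB₂ hB₃, by linarith, ?_⟩
  intro i ε₁ V U hε₁ _ hV hU hB hcrit c hMc
  -- (ε₁ ≤ a₁ is implied on every class cube by R₁M₁ ≤ M ≤ R₁M₁(a₁/ε₁); the restrictions are read off M directly)
  exact regularity_of_leaves (hLv i) hd hL hB₁ hB₃ hK hR hε₁ hV hU hB hcrit c hMc

end SecondCase

/-! ## §4 Theorem 1 from Proposition 7 and the leaves of Sect. F -/

/-- **Theorem 1 ⇐ Proposition 7 ∧ the located leaves of Sect. F** (by name, through the gen-7 chain `B11Prop8Assembly.thm1Printed_of_step`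
= Prop. 8 by the halving iteration + `B11.thm1_of_prop7_prop8_sectF`): with the carrier dictionary `VarProblemX.Laws`, the typed Theorem 1
(`B11.Thm1Printed`) follows from `B11.Prop7Printed` and `Leaves` for every member of the family.
[cite: Balaban1985Variational, Thm 1 p.279 + Prop. 8 p.304 + Sect. F (169) p.305] -/
theorem thm1Printed_of_prop7_leaves (fam : I → VarProblemX) (D : ∀ i, CubeData (fam i)) {d L B₁ B₂ B₃ K R₁M₁ c₁ a₃ a₄ C₁ : ℝ}
    (hLv : ∀ i, Leaves (fam i) (D i) d L B₁ B₂ B₃ K R₁M₁ c₁ a₃ a₄) (hd : 1 ≤ d) (hL : 0 < L) (hB₁ : 0 < B₁)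
    (hB₂ : 0 < B₂) (hB₃ : 0 < B₃) (hK : 0 < K) (hR : 1 ≤ R₁M₁) (hc₁ : 0 < c₁) (ha₃ : 0 < a₃) (ha₄ : 0 < a₄) (hC₁ : 0 < C₁)
    (laws : ∀ i, (fam i).Laws) (h7 : Prop7Printed B₃ C₁ fam) : Thm1Printed (fun i => (fam i).toVarProblem) :=
  thm1Printed_of_step fam hB₃ hC₁ (a5_pos (by linarith) hL hB₁ hK (by linarith) hc₁ ha₃ ha₄) laws h7
    (fun i => halvingStep_of_leaves (hLv i) hd hL hB₁ hB₃ hK (by linarith) (laws i).1)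
    (sectFPrinted_of_leaves fam D hLv (by linarith) hL hB₁ hB₂ hB₃ hK hR hc₁ ha₃ ha₄)

end Literature.MathematicalPhysics.QuantumFieldTheory.Balaban1983to89.B11SectFAssembly
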